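import Literature.Probability.LatticeModels.DoubleCurrentsInfinite
import Literature.Probability.LatticeModels.RandomCurrentsProofs
import Literature.Probability.LatticeModels.IsingThermodynamics
import HarnessLib

/-!
# Sourced double random currents on `ℤ^d`: the finite-volume trace laws `P^{A,B}_{Λ_L,β}` and
# their infinite-volume weak limit `P^{A,B}_β`

Topic `Probability/LatticeModels`; namespace `Literature.Probability.LatticeModels` (next to
`DoubleCurrents.lean`, `DoubleCurrentsInfinite.lean`).  Definition request
`defn-SourcedDoubleCurrentZ3` (route CriticalPhenomena/EnergyNotSigmaSquared).

## Source

M. Aizenman, H. Duminil-Copin, *Marginal triviality of the scaling limits of critical 4D Ising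
and `λφ⁴₄` models*, Ann. of Math. 194 (2021) [AizenmanDuminilCopinAnnals2021] (arXiv:1912.07973,
read §3.1–3.2): for a finite `Λ ⊂ ℤ^d` and `A ⊂ Λ`, `P^A_{Λ,β}(n) ∝ w(n) 𝟙[∂n = A]` is "the
probability distribution on random currents constrained by the source condition `∂n = A`", and
`P^{A_1,…,A_i}_{Λ,β} := P^{A_1}_{Λ,β} ⊗ ⋯ ⊗ P^{A_i}_{Λ,β}` "the law of an independent family of
currents"; "Existing continuity results [ADS15] permit to extend (3.9) to the infinite volume,
expressed in terms of the weak limits of the random current measures `P^A_{Λ_n,β}` and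
`P^{A_1,…,A_i}_{Λ_n,β}`, in the limit `Λ_n ↗ ℤ^d`" (§3.2; the footnote there: for `β ≤ β_c`,
`n₁ + n₂` has no infinite path a.s., by [Aiz82] for `β < β_c` and [ADS15] at `β_c`), with the
infinite-volume identity `⟨σ_A⟩_β ⟨σ_B⟩_β / ⟨σ_A σ_B⟩_β = P^{AΔB,∅}_β[n₁ + n₂ ∈ 𝓕_B]` and
`U₄^β(x,y,z,t) = −2⟨σ_xσ_y⟩⟨σ_zσ_t⟩ P^{xy,zt}_β[C_{n₁+n₂}(x) ∩ C_{n₁+n₂}(z) ≠ ∅]` ((3.11)–(3.12) of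
the arXiv version), whose events only involve the clusters of the SUM of the two currents.

## What is defined

Everything the route's items use about `P^{A,B}_β` concerns the clusters `C_{n₁+n₂}(v)`, i.e. the
TRACE `n̂₁ ∪ n̂₂ = {e : (n₁+n₂)_e > 0}` of the sum, a bond configuration of `ℤ^d`; we therefore
realise the sourced double currents, exactly as the tree realises ADS15's sourceless `ℙ_β`
(`adsDoubleCurrentLaw`, `IsAdsLimit`, `adsDoubleCurrentLawInf` in `DoubleCurrentsInfinite.lean`),
as laws on `BondConfig (Site d)`:

* `boxSources d L A` — a finite `A ⊂ ℤ^d` read as a set of vertices of the box graph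
  `freeBoxGraph d L` (vertex type `BoxVertex d L = ↥Λ_{L+1}`);
* `sourcedTrace d L (n₁, n₂) = liftBonds (n₁ + n₂)^` — the trace of the sum, lifted to `ℤ^d`;
* **`sourcedDoubleCurrentLaw d L β A B`** — the finite-volume law `P^{A,B}_{Λ_L,β}` of that trace:
  the push-forward of the tree's `doubleCurrentMeasure (freeBoxGraph d L) β (boxSources A) (boxSources B)`
  (free boundary condition; `= P^A_{Λ_L,β} ⊗ P^B_{Λ_L,β}` of ADC21); a probability measure for
  `β ≥ 0` as soon as currents with the prescribed sources exist
  (`isProbabilityMeasure_sourcedDoubleCurrentLaw`), junk `0` otherwise (e.g. `#A` odd, or `A ⊄ Λ_L`);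
* **`IsSourcedDoubleCurrentLimit d β A B μ`** — `μ` is an infinite-volume sourced double current:
  a probability measure to which `P^{A,B}_{Λ_L,β}` converges on every local event as `L → ∞`
  (ADC21's "weak limits of `P^{A_1,…,A_i}_{Λ_n,β}`", read on the trace); unique when it exists
  (`IsSourcedDoubleCurrentLimit.unique`, π-system of local events);
* **`sourcedDoubleCurrentLawInf d β A B = P^{A,B}_β`** — that limit (by choice; junk `0` if none),
  and `sourcedFourCurrentLawInf d β A B A' B'`, the product of two of them = the law of the pair of
  traces `((n₁+n₃)^, (n₂+n₄)^)` under ADC21's `P^{A,A',B,B'}` with the pairing `(n₁,n₃)`, `(n₂,n₄)`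
  of (3.13) (four independent currents);
* `abbrev SourcedDoubleCurrentZ3 β A B μ := IsSourcedDoubleCurrentLimit 3 β A B μ` — the notion at
  `d = 3`, the case in use (at `β = β_c(3)`);
* `clusterExitBonds d r ω v` / `clusterBoundaryFlux` — the open bonds of `ω` with one endpoint in
  the cluster `C_ω(v) ∩ Λ_r` and the other outside `Λ_r` (the flux of the cluster of `v` through
  `∂Λ_r`), and the cluster itself is the tree's `openCluster ω v`.

One named fact: `sourcedDoubleCurrent_limit_exists` — for `0 < β ≤ β_c(d)` and source sets of
even cardinality the weak limit exists (the existence assertion in ADC21 §3.2 quoted above, resting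
on ADS15 Thm. 2.3).  NOT here: the laws of the individual currents `n₁`, `n₂` and of their values
(only the trace of the sum is retained), the one-site density
`P^{0x,∅}_β[u ∈ C(0)] = ⟨σ₀σ_u⟩⟨σ_uσ_x⟩/⟨σ₀σ_x⟩` in infinite volume (its finite-volume form is the
tree's `tsum_epairWeight_mul_indicator_mem_cluster`; `{u ∈ C(0)}` is not a local event, so the
passage to the limit is a statement of its own), shift covariance `P^{A+v,B+v}_β = τ_v P^{A,B}_β`.

## References

* M. Aizenman, H. Duminil-Copin, Ann. of Math. 194 (2021), §3.1 (Lemma 3.3, `P^A_{Λ,β}`,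
  `P^{A_1,…,A_i}_{Λ,β}`), §3.2 (infinite volume; (3.11)–(3.13)). [AizenmanDuminilCopinAnnals2021]
* M. Aizenman, H. Duminil-Copin, V. Sidoravicius, Comm. Math. Phys. 334 (2015), Thm. 2.3, §2.3
  (weak limits of finite-volume currents). [AizenmanDuminilCopinSidoraviciusCMP2015]
* M. Aizenman, Comm. Math. Phys. 86 (1982), §3. [Aizenman1982]
-/

noncomputable section

open MeasureTheory Filter Topology Finset Literature.Probability.Percolation
open scoped symmDiff

namespace Literature.Probability.LatticeModels

variable (d : ℕ)

/-! ### Sources inside a box, and the lifted trace of a pair of currents -/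

/-- A finite set `A ⊂ ℤ^d` of prescribed sources, read inside the vertex type `BoxVertex d L` of
the box graphs (the vertices `a` with `↑a ∈ A`); for `A ⊆ Λ_{L+1}` it has the same cardinality as
`A`. [cite: AizenmanDuminilCopinAnnals2021, §3.2] -/
def boxSources (L : ℕ) (A : Finset (Site d)) : Finset (BoxVertex d L) :=
  univ.filter fun a => (a : Site d) ∈ A

variable {d} in
/-- Membership in `boxSources`. [folklore] -/
@[simp]
theorem mem_boxSources_iff {L : ℕ} {A : Finset (Site d)} {a : BoxVertex d L} :
    a ∈ boxSources d L A ↔ (a : Site d) ∈ A := by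
  simp [boxSources]

variable {d} in
/-- No sources: `boxSources d L ∅ = ∅`. [folklore] -/
@[simp]
theorem boxSources_empty (L : ℕ) : boxSources d L (∅ : Finset (Site d)) = ∅ := by
  ext a
  simp

/-- The trace `{e : (n₁ + n₂)_e > 0} = n̂₁ ∪ n̂₂` of the sum of a pair of currents of the free box
graph, lifted to a bond configuration of `ℤ^d` (`liftBonds`; bonds outside `Λ_L` closed) — the
object whose clusters are ADC21's `C_{n₁+n₂}(v)`. [cite: AizenmanDuminilCopinAnnals2021, §3.2] -/
def sourcedTrace (L : ℕ) (p : Current (freeBoxGraph d L) × Current (freeBoxGraph d L)) :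
    BondConfig (Site d) :=
  liftBonds d L (p.1 + p.2).traced

variable {d} in
/-- The lifted trace of the sum is the union of the two lifted traces (`Current.traced_add`).
[folklore] -/
theorem sourcedTrace_eq_union (L : ℕ) (p : Current (freeBoxGraph d L) × Current (freeBoxGraph d L)) :
    sourcedTrace d L p = liftBonds d L p.1.traced ∪ liftBonds d L p.2.traced := by
  rw [sourcedTrace, Current.traced_add, liftBonds, liftBonds, liftBonds, Set.image_union]

variable {d} in
/-- Every map out of the (countable, discrete) space of pairs of currents of a finite graph is
measurable; in particular `sourcedTrace`. [folklore] -/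
theorem measurable_sourcedTrace (L : ℕ) : Measurable (sourcedTrace d L) :=
  measurable_of_countable _

/-! ### The finite-volume sourced double current `P^{A,B}_{Λ_L,β}` -/

/-- **The finite-volume sourced double current `P^{A,B}_{Λ_L,β}`** (free boundary condition) read
on the trace: the law, on bond configurations of `ℤ^d`, of `n̂₁ ∪ n̂₂` for an independent pair
`(n₁, n₂) ∼ P^A_{Λ_L,β} ⊗ P^B_{Λ_L,β}` of currents of the box `Λ_L` with sources `∂n₁ = A`,
`∂n₂ = B` (ADC21 §3.1: `P^A_{Λ,β}(n) ∝ w(n) 𝟙[∂n = A]`, `P^{A,B} = P^A ⊗ P^B`), i.e. the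
push-forward under `sourcedTrace` of the tree's `doubleCurrentMeasure (freeBoxGraph d L) β _ _`.
Junk: the zero measure when no current of `Λ_L` has sources `A` (or `B`) — `#A` odd, or
`A ⊄ Λ_L` — and meaningless for `β < 0` (inherited from `doubleCurrentMeasure`).
[cite: AizenmanDuminilCopinAnnals2021, §3.1] -/
def sourcedDoubleCurrentLaw (L : ℕ) (β : ℝ) (A B : Finset (Site d)) : Measure (BondConfig (Site d)) :=
  (doubleCurrentMeasure (freeBoxGraph d L) β (boxSources d L A) (boxSources d L B)).map
    (sourcedTrace d L)

variable {d} in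
/-- `P^{A,B}_{Λ_L,β}[S] = (P^A ⊗ P^B)_{Λ_L,β}[sourcedTrace ⁻¹ S]` for measurable `S`. [folklore] -/
theorem sourcedDoubleCurrentLaw_apply (L : ℕ) (β : ℝ) (A B : Finset (Site d))
    {S : Set (BondConfig (Site d))} (hS : MeasurableSet S) :
    sourcedDoubleCurrentLaw d L β A B S =
      doubleCurrentMeasure (freeBoxGraph d L) β (boxSources d L A) (boxSources d L B)
        (sourcedTrace d L ⁻¹' S) := by
  rw [sourcedDoubleCurrentLaw, Measure.map_apply (measurable_sourcedTrace L) hS]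

variable {d} in
/-- For `β ≥ 0`, if currents of `Λ_L` with sources `A` and with sources `B` exist (nonvanishing
`currentSum`), `P^{A,B}_{Λ_L,β}` is a probability measure (tree:
`isProbabilityMeasure_doubleCurrentMeasure_holds`). [folklore] -/
theorem isProbabilityMeasure_sourcedDoubleCurrentLaw {L : ℕ} {β : ℝ} (hβ : 0 ≤ β)
    {A B : Finset (Site d)} (hA : currentSum (freeBoxGraph d L) β (boxSources d L A) ≠ 0)
    (hB : currentSum (freeBoxGraph d L) β (boxSources d L B) ≠ 0) :
    IsProbabilityMeasure (sourcedDoubleCurrentLaw d L β A B) := by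
  haveI := isProbabilityMeasure_doubleCurrentMeasure_holds (freeBoxGraph d L) hβ hA hB
  exact Measure.isProbabilityMeasure_map (measurable_sourcedTrace L).aemeasurable

/-! ### The infinite-volume sourced double current `P^{A,B}_β` -/

/-- `μ` **is the infinite-volume sourced double current `P^{A,B}_β`** (read on the trace of the
sum): a probability measure on bond configurations of `ℤ^d` to which the finite-volume laws
`P^{A,B}_{Λ_L,β}` converge on every local event (event depending on finitely many bonds) as
`L → ∞` — ADC21 §3.2, "the weak limits of the random current measures `P^A_{Λ_n,β}` and
`P^{A_1,…,A_i}_{Λ_n,β}`, in the limit `Λ_n ↗ ℤ^d`", for two currents.  Unique when it exists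
(`IsSourcedDoubleCurrentLimit.unique`). [cite: AizenmanDuminilCopinAnnals2021, §3.2] -/
structure IsSourcedDoubleCurrentLimit (β : ℝ) (A B : Finset (Site d))
    (μ : Measure (BondConfig (Site d))) : Prop where
  /-- `P^{A,B}_β` is a probability measure. -/
  isProbabilityMeasure : IsProbabilityMeasure μ
  /-- Convergence on local events. -/
  tendsto_local : ∀ S : Set (BondConfig (Site d)), IsLocalEvent S →
    Tendsto (fun L : ℕ => (sourcedDoubleCurrentLaw d L β A B).real S) atTop (𝓝 (μ.real S))

/-- **`SourcedDoubleCurrentZ3 β A B μ`**: `μ` is the infinite-volume sourced double current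
`P^{A,B}_β` on `ℤ³` — the notion of the definition request, `IsSourcedDoubleCurrentLimit` at
`d = 3` (used at `β = β_c(3)`). [cite: AizenmanDuminilCopinAnnals2021, §3.2] -/
abbrev SourcedDoubleCurrentZ3 (β : ℝ) (A B : Finset (Site 3)) (μ : Measure (BondConfig (Site 3))) :
    Prop :=
  IsSourcedDoubleCurrentLimit 3 β A B μ

open Classical in
/-- **The infinite-volume sourced double current `P^{A,B}_β`** on `ℤ^d` (law of the trace
`n̂₁ ∪ n̂₂`), the weak limit of `P^{A,B}_{Λ_L,β}` on local events when it exists; **junk value**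
`0` otherwise (existence for `0 < β ≤ β_c(d)` and even `#A`, `#B` is the named fact
`sourcedDoubleCurrent_limit_exists`). [cite: AizenmanDuminilCopinAnnals2021, §3.2] -/
def sourcedDoubleCurrentLawInf (β : ℝ) (A B : Finset (Site d)) : Measure (BondConfig (Site d)) :=
  if h : ∃ μ, IsSourcedDoubleCurrentLimit d β A B μ then h.choose else 0

variable {d} in
/-- If a weak limit exists, `sourcedDoubleCurrentLawInf` is one. [folklore] -/
theorem isSourcedDoubleCurrentLimit_lawInf {β : ℝ} {A B : Finset (Site d)}
    (h : ∃ μ, IsSourcedDoubleCurrentLimit d β A B μ) :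
    IsSourcedDoubleCurrentLimit d β A B (sourcedDoubleCurrentLawInf d β A B) := by
  rw [sourcedDoubleCurrentLawInf, dif_pos h]
  exact h.choose_spec

variable {d} in
/-- **Uniqueness of the infinite-volume sourced double current**: two probability measures to
which `P^{A,B}_{Λ_L,β}` converges on all local events coincide (local events form a π-system
generating the σ-algebra, `ext_of_isLocalEvent`). [folklore] -/
theorem IsSourcedDoubleCurrentLimit.unique {β : ℝ} {A B : Finset (Site d)}
    {μ ν : Measure (BondConfig (Site d))} (hμ : IsSourcedDoubleCurrentLimit d β A B μ)
    (hν : IsSourcedDoubleCurrentLimit d β A B ν) : μ = ν := by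
  haveI := hμ.isProbabilityMeasure
  haveI := hν.isProbabilityMeasure
  refine ext_of_isLocalEvent fun S hS => ?_
  have h := tendsto_nhds_unique (hμ.tendsto_local S hS) (hν.tendsto_local S hS)
  rw [measureReal_def, measureReal_def] at h
  exact (ENNReal.toReal_eq_toReal_iff' (measure_ne_top μ S) (measure_ne_top ν S)).1 h

variable {d} in
/-- Hence any weak limit **is** `sourcedDoubleCurrentLawInf d β A B`. [folklore] -/
theorem IsSourcedDoubleCurrentLimit.eq_lawInf {β : ℝ} {A B : Finset (Site d)}
    {μ : Measure (BondConfig (Site d))} (hμ : IsSourcedDoubleCurrentLimit d β A B μ) :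
    μ = sourcedDoubleCurrentLawInf d β A B :=
  hμ.unique (isSourcedDoubleCurrentLimit_lawInf ⟨μ, hμ⟩)

variable {d} in
/-- When the limit exists, `P^{A,B}_β` gives every local event the limit of its finite-volume
probabilities. [folklore] -/
theorem tendsto_sourcedDoubleCurrentLaw_real {β : ℝ} {A B : Finset (Site d)}
    (h : ∃ μ, IsSourcedDoubleCurrentLimit d β A B μ) {S : Set (BondConfig (Site d))}
    (hS : IsLocalEvent S) :
    Tendsto (fun L : ℕ => (sourcedDoubleCurrentLaw d L β A B).real S) atTop
      (𝓝 ((sourcedDoubleCurrentLawInf d β A B).real S)) :=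
  (isSourcedDoubleCurrentLimit_lawInf h).tendsto_local S hS

/-- **Four independent currents** (two independent sourced pairs): the law of the pair of traces
`((n₁+n₃)^, (n₂+n₄)^)` for `(n₁, n₃) ∼ P^{A,B}_β` and `(n₂, n₄) ∼ P^{A',B'}_β` independent — the
object behind ADC21's `P^{xy,zt,∅,∅}_β[C_{n₁+n₃}(x) ∩ C_{n₂+n₄}(z) ≠ ∅]` ((3.13) of the arXiv
version, `A = xy`, `A' = zt`, `B = B' = ∅`). [cite: AizenmanDuminilCopinAnnals2021, §3.2] -/
def sourcedFourCurrentLawInf (β : ℝ) (A B A' B' : Finset (Site d)) :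
    Measure (BondConfig (Site d) × BondConfig (Site d)) :=
  (sourcedDoubleCurrentLawInf d β A B).prod (sourcedDoubleCurrentLawInf d β A' B')

/-- **Existence of the infinite-volume sourced double currents** (named fact).  ADC21 §3.2:
"Existing continuity results [ADS15] permit to extend (3.9) to the infinite volume, expressed in
terms of the weak limits of the random current measures `P^A_{Λ_n,β}` and `P^{A_1,…,A_i}_{Λ_n,β}`,
in the limit `Λ_n ↗ ℤ^d`" (used there for `β ≤ β_c`), resting on ADS15 Thm. 2.3 (convergence of
the finite-volume currents on events depending on finitely many edges).  Formal reading, on the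
trace of the sum of two currents with free boundary condition: for the nearest-neighbour Ising
model on `ℤ^d`, `d ≥ 2`, every `0 < β ≤ β_c(d)` and all finite `A, B ⊂ ℤ^d` of even cardinality
(otherwise no current has these sources), the laws `P^{A,B}_{Λ_L,β}` converge on local events to a
probability measure. [cite: AizenmanDuminilCopinAnnals2021, §3.2] -/
def sourcedDoubleCurrent_limit_exists : Prop :=
  2 ≤ d → ∀ ⦃β : ℝ⦄, 0 < β → β ≤ criticalBeta d → ∀ (A B : Finset (Site d)),
    Even A.card → Even B.card → ∃ μ, IsSourcedDoubleCurrentLimit d β A B μ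

/-! ### Clusters and their flux through the boundary of a box -/

/-- The open bonds of `ω` joining a site of the cluster `C_ω(v)` (tree `openCluster`) inside the box
`Λ_r` to a site outside `Λ_r`: the crossings of `∂Λ_r` by the cluster of `v` (for `ω` the trace of
`n₁ + n₂`, the places where `C_{n₁+n₂}(v)` exits the box). [folklore] -/
def clusterExitBonds (r : ℕ) (ω : BondConfig (Site d)) (v : Site d) : Set (Sym2 (Site d)) :=
  {e | e ∈ ω ∧ ∃ x y : Site d, e = s(x, y) ∧ x ∈ openCluster ω v ∧ x ∈ box d r ∧ y ∉ box d r}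

variable {d} in
/-- Exit bonds are open bonds. [folklore] -/
theorem clusterExitBonds_subset (r : ℕ) (ω : BondConfig (Site d)) (v : Site d) :
    clusterExitBonds d r ω v ⊆ ω := fun _ h => h.1

variable {d} in
/-- The closed configuration has no exit bonds. [folklore] -/
@[simp]
theorem clusterExitBonds_empty (r : ℕ) (v : Site d) : clusterExitBonds d r (∅ : BondConfig (Site d)) v = ∅ :=
  Set.eq_empty_of_subset_empty (clusterExitBonds_subset r ∅ v)

/-- **The flux of the cluster of `v` through `∂Λ_r`**: the number of its exit bonds (`Set.encard`,
`⊤` if infinite). [folklore] -/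
def clusterBoundaryFlux (r : ℕ) (ω : BondConfig (Site d)) (v : Site d) : ℕ∞ :=
  (clusterExitBonds d r ω v).encard

variable {d} in
/-- The closed configuration has zero flux. [folklore] -/
@[simp]
theorem clusterBoundaryFlux_empty (r : ℕ) (v : Site d) :
    clusterBoundaryFlux d r (∅ : BondConfig (Site d)) v = 0 := by
  simp [clusterBoundaryFlux]

end Literature.Probability.LatticeModels
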